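import Summits.ResolutionOfSingularities.ResolutionOfSingularities.Theorems.FrobeniusLadderFInjectiveMacaulayficationCoordinateSlicing
import Summits.ResolutionOfSingularities.ResolutionOfSingularities.Theorems.FrobeniusLadderFInjectiveMacaulayficationHWeightedData
import Summits.ResolutionOfSingularities.ResolutionOfSingularities.Theorems.FrobeniusLadderFInjectiveMacaulayficationFedderAtMaximalIdeal
import Summits.ResolutionOfSingularities.ResolutionOfSingularities.Theorems.FrobeniusLadderFInjectiveMacaulayficationHypersurfaceRegular
import Summits.ResolutionOfSingularities.ResolutionOfSingularities.Theorems.FrobeniusLadderFInjectiveMacaulayficationFiClauseOfRegular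
import Mathlib.Algebra.MvPolynomial.Equiv
import Mathlib.Algebra.MvPolynomial.PDeriv
import Mathlib.Algebra.CharP.Lemmas
import Mathlib.Logic.Equiv.Fin.Basic
import HarnessLib

/-!
# Fedder certificates for `h = X₂² + X₃²(X₁⁶ + X₀³) + X₀²X₃³` at `p = 5` along its singular locus off the origin
# (crux `FInjectiveMacaulayfication`, line `graded-engine` §16, calibration G6c)

Support file for crux stmt-ResolutionOfSingularities-15315 (`FrobeniusLadder.FInjectiveMacaulayfication`), chain w45a,
seat res-L1-w45a-stub-3. [OURS · L1 W4.5a, CRUX-PLAN v3 §C, calibration G6c] — NOT a statement of the manuscript;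
AI-written, weaker than expert review.

`V(h) ⊂ 𝔸⁴` is singular along the PLANE `{X₂ = X₃ = 0}` and the LINE `{X₀ = X₁ = X₂ = 0}` (tri-1 F4 / tri-2 F10), so the
off-origin clause hypothesis `hoff` of the graded engine cannot come from regularity there: it comes from Fedder's criterion
at ARBITRARY closed points (`FedderAtMaximalIdeal.stub_fedderAtMaximalIdeal`), run uniformly along each stratum with the
slicing machinery of `CoordinateSlicing` (generators of the closed point + one extracted coefficient), in characteristic `5`:

* `clause_plane_char5` — at a closed point `P ⊋ (X₂, X₃)`, `P ≠ 𝔪`: slicing `k[X] ≃ B[Y₀,Y₁]`, `B = k[X₀,X₁]`, `Y = (X₂,X₃)`;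
  `h⁴ ≡ 6·φ²·Y₀⁴Y₁⁴ (mod Y₀⁵, Y₁⁵)` with `φ = X₁⁶ + X₀³` (`(2,2,0)`-term of the trinomial expansion, coefficient `4!/2!2! = 6`,
  a unit), so `h⁴ ∈ P^[5]` forces `φ² ∈ 𝔭^[5] ⊆ 𝔭` (`𝔭 = P ∩ B`, coefficient extraction). If `φ ∉ 𝔭` this is absurd; if `φ ∈ 𝔭`
  then `X₀ ∉ 𝔭` (else `𝔭 = (X₀,X₁)`, `P = 𝔪`), `∂₀φ = 3X₀² ∉ 𝔭`, the curve `B_𝔭/(φ)` is REGULAR, hence satisfies the clause, hence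
  — Fedder's criterion read BACKWARDS (`FedderAtMaximalIdeal.fedder_criterion_maximalIdeal`) — `φ⁴ ∉ 𝔭^[5]`, contradicting
  `φ² ∈ 𝔭^[5]`;
* `clause_axis_char5` — at a closed point `P ⊋ (X₀, X₁, X₂)` with `X₃ ∉ P`: slicing `k[X] ≃ B'[Y₀,Y₁,Y₂]`, `B' = k[X₃]`;
  `h⁴ ≡ 6·X₃⁶·Y₀⁴Y₂⁴ (mod Y₀⁵, Y₁⁵, Y₂⁵)`, so `h⁴ ∈ P^[5]` forces `X₃⁶ ∈ 𝔭' ⊆ k[X₃]`, i.e. `X₃ ∈ P` — excluded.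

Supporting: `exists_planeSlicing`, `exists_axisSlicing` (the two slicings as ring isomorphisms with their values on the
variables), the two quartic identities (`ring`), units `3, 6` in characteristic `5`. All proofs are glue on Mathlib and landed
files; no definitions, no named facts. References: [Fedder1983] R. Fedder, *F-purity and rational singularity*, Trans. AMS 278
(1983), Prop. 1.7, Thm. 1.12 (through the imported criterion). [folklore]
-/

-- single-problem summit: the doubled namespace component is forced
set_option linter.dupNamespace false

noncomputable section

namespace Summit.ResolutionOfSingularities.ResolutionOfSingularities.Theorems.FInjectiveMacaulayfication.HFedderCertificates

open MvPolynomial IsLocalRing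
open Summit.ResolutionOfSingularities.ResolutionOfSingularities.Theorems.FInjectiveMacaulayfication

/-! ## Small tools -/

/-- A multiple of `Y_s^N` has no `Y^d`-term when `d_s < N`. [folklore] -/
theorem coeff_X_pow_mul_eq_zero {σ R : Type*} [CommSemiring R] (d : σ →₀ ℕ) (s : σ) (N : ℕ) (hN : d s < N)
    (G : MvPolynomial σ R) : coeff d (X s ^ N * G) = 0 := by
  rw [X_pow_eq_monomial, coeff_monomial_mul', if_neg]
  rw [Finsupp.single_le_iff]
  exact not_le.mpr hN

/-- `3` is a unit in characteristic `5` (in any polynomial ring over the field). [folklore] -/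
theorem isUnit_three_char5 (k : Type) [Field k] [CharP k 5] {σ : Type*} : IsUnit (3 : MvPolynomial σ k) := by
  have h3 : (3 : k) ≠ 0 := by
    intro h
    have h' : ((3 : ℕ) : k) = 0 := by exact_mod_cast h
    rw [CharP.cast_eq_zero_iff k 5 3] at h'
    omega
  have hu := (isUnit_iff_ne_zero.mpr h3).map (C : k →+* MvPolynomial σ k)
  rwa [map_ofNat] at hu

/-- `6` is a unit in characteristic `5` (in any polynomial ring over the field). [folklore] -/
theorem isUnit_six_char5 (k : Type) [Field k] [CharP k 5] {σ : Type*} : IsUnit (6 : MvPolynomial σ k) := by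
  have h6 : (6 : k) ≠ 0 := by
    intro h
    have h' : ((6 : ℕ) : k) = 0 := by exact_mod_cast h
    rw [CharP.cast_eq_zero_iff k 5 6] at h'
    omega
  have hu := (isUnit_iff_ne_zero.mpr h6).map (C : k →+* MvPolynomial σ k)
  rwa [map_ofNat] at hu

/-! ## The two slicings -/

/-- **Plane slicing** `k[X₀,…,X₃] ≃ B[Y₀,Y₁]`, `B = k[X₀,X₁]`: `X₀ ↦ C X₀`, `X₁ ↦ C X₁`, `X₂ ↦ Y₀`, `X₃ ↦ Y₁`
(`renameEquiv` along `Fin 4 ≃ Fin 2 ⊕ Fin 2` followed by `sumAlgEquiv`). [folklore] -/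
theorem exists_planeSlicing (k : Type) [Field k] :
    ∃ Ψ : MvPolynomial (Fin 4) k ≃+* MvPolynomial (Fin 2) (MvPolynomial (Fin 2) k),
      Ψ (X 0) = C (X 0) ∧ Ψ (X 1) = C (X 1) ∧ Ψ (X 2) = X 0 ∧ Ψ (X 3) = X 1 := by
  have e0 : (finSumFinEquiv.symm.trans (Equiv.sumComm (Fin 2) (Fin 2))) (0 : Fin 4) = Sum.inr 0 := by decide
  have e1 : (finSumFinEquiv.symm.trans (Equiv.sumComm (Fin 2) (Fin 2))) (1 : Fin 4) = Sum.inr 1 := by decide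
  have e2 : (finSumFinEquiv.symm.trans (Equiv.sumComm (Fin 2) (Fin 2))) (2 : Fin 4) = Sum.inl 0 := by decide
  have e3 : (finSumFinEquiv.symm.trans (Equiv.sumComm (Fin 2) (Fin 2))) (3 : Fin 4) = Sum.inl 1 := by decide
  refine ⟨((renameEquiv k (finSumFinEquiv.symm.trans (Equiv.sumComm (Fin 2) (Fin 2)))).trans
    (sumAlgEquiv k (Fin 2) (Fin 2))).toRingEquiv, ?_, ?_, ?_, ?_⟩
  · show sumAlgEquiv k (Fin 2) (Fin 2) (rename _ (X 0)) = _
    rw [rename_X, e0]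
    exact sumAlgEquiv_X_inr _ _ _ _
  · show sumAlgEquiv k (Fin 2) (Fin 2) (rename _ (X 1)) = _
    rw [rename_X, e1]
    exact sumAlgEquiv_X_inr _ _ _ _
  · show sumAlgEquiv k (Fin 2) (Fin 2) (rename _ (X 2)) = _
    rw [rename_X, e2]
    exact sumAlgEquiv_X_inl _ _ _ _
  · show sumAlgEquiv k (Fin 2) (Fin 2) (rename _ (X 3)) = _
    rw [rename_X, e3]
    exact sumAlgEquiv_X_inl _ _ _ _

/-- **Axis slicing** `k[X₀,…,X₃] ≃ B'[Y₀,Y₁,Y₂]`, `B' = k[X₃]` (one variable, as `MvPolynomial (Fin 1) k`): `Xⱼ ↦ Yⱼ` (`j ≤ 2`),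
`X₃ ↦ C X₀` (`renameEquiv` along `finSumFinEquiv.symm : Fin 4 ≃ Fin 3 ⊕ Fin 1` followed by `sumAlgEquiv`). [folklore] -/
theorem exists_axisSlicing (k : Type) [Field k] :
    ∃ Ψ : MvPolynomial (Fin 4) k ≃+* MvPolynomial (Fin 3) (MvPolynomial (Fin 1) k),
      Ψ (X 0) = X 0 ∧ Ψ (X 1) = X 1 ∧ Ψ (X 2) = X 2 ∧ Ψ (X 3) = C (X 0) := by
  have e0 : (@finSumFinEquiv 3 1).symm 0 = Sum.inl 0 := by decide
  have e1 : (@finSumFinEquiv 3 1).symm 1 = Sum.inl 1 := by decide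
  have e2 : (@finSumFinEquiv 3 1).symm 2 = Sum.inl 2 := by decide
  have e3 : (@finSumFinEquiv 3 1).symm 3 = Sum.inr 0 := by decide
  refine ⟨((renameEquiv k (@finSumFinEquiv 3 1).symm).trans
    (sumAlgEquiv k (Fin 3) (Fin 1))).toRingEquiv, ?_, ?_, ?_, ?_⟩
  · show sumAlgEquiv k (Fin 3) (Fin 1) (rename _ (X 0)) = _
    rw [rename_X, e0]
    exact sumAlgEquiv_X_inl _ _ _ _
  · show sumAlgEquiv k (Fin 3) (Fin 1) (rename _ (X 1)) = _
    rw [rename_X, e1]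
    exact sumAlgEquiv_X_inl _ _ _ _
  · show sumAlgEquiv k (Fin 3) (Fin 1) (rename _ (X 2)) = _
    rw [rename_X, e2]
    exact sumAlgEquiv_X_inl _ _ _ _
  · show sumAlgEquiv k (Fin 3) (Fin 1) (rename _ (X 3)) = _
    rw [rename_X, e3]
    exact sumAlgEquiv_X_inr _ _ _ _

/-! ## The two quartic identities -/

/-- **The plane expansion**: in `B[Y₀,Y₁]`, writing `u = c₁ + c₂Y₁`,
`(Y₀² + Y₁²u)⁴ = 6c₁²·Y₀⁴Y₁⁴ + Y₀⁵·(…) + Y₁⁵·(…)` — the only term with both exponents `< 5` is the `(2,2,0)`-term. [folklore] -/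
theorem plane_quartic_identity {R : Type*} [CommRing R] (Y₀ Y₁ c₁ c₂ : R) :
    (Y₀ ^ 2 + Y₁ ^ 2 * c₁ + c₂ * Y₁ ^ 3) ^ 4 =
      6 * c₁ ^ 2 * (Y₀ ^ 4 * Y₁ ^ 4) +
      Y₀ ^ 5 * (Y₀ ^ 3 + 4 * Y₀ * Y₁ ^ 2 * (c₁ + c₂ * Y₁)) +
      Y₁ ^ 5 * (12 * c₁ * c₂ * Y₀ ^ 4 + 6 * c₂ ^ 2 * Y₀ ^ 4 * Y₁ + 4 * Y₀ ^ 2 * Y₁ * (c₁ + c₂ * Y₁) ^ 3 +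
        Y₁ ^ 3 * (c₁ + c₂ * Y₁) ^ 4) := by
  ring

/-- **The axis expansion**: in `B'[Y₀,Y₁,Y₂]`, with `c` the image of `X₃`, `u = c²Y₀ + c³`, `x = Y₂² + Y₀²u`, `b = c²Y₁⁶`,
`(x + b)⁴ = 6c⁶·Y₀⁴Y₂⁴ + Y₀⁵·(…) + Y₁⁵·(…) + Y₂⁵·(…)`. [folklore] -/
theorem axis_quartic_identity {R : Type*} [CommRing R] (Y₀ Y₁ Y₂ c : R) :
    (Y₂ ^ 2 + c ^ 2 * (Y₁ ^ 6 + Y₀ ^ 3) + Y₀ ^ 2 * c ^ 3) ^ 4 =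
      6 * c ^ 6 * (Y₀ ^ 4 * Y₂ ^ 4) +
      Y₀ ^ 5 * (6 * c ^ 4 * Y₂ ^ 4 * Y₀ + 12 * c ^ 5 * Y₂ ^ 4 + 4 * Y₂ ^ 2 * Y₀ * (c ^ 2 * Y₀ + c ^ 3) ^ 3 +
        Y₀ ^ 3 * (c ^ 2 * Y₀ + c ^ 3) ^ 4) +
      Y₁ ^ 5 * (c ^ 2 * Y₁ * (4 * (Y₂ ^ 2 + Y₀ ^ 2 * (c ^ 2 * Y₀ + c ^ 3)) ^ 3 +
        6 * (Y₂ ^ 2 + Y₀ ^ 2 * (c ^ 2 * Y₀ + c ^ 3)) ^ 2 * (c ^ 2 * Y₁ ^ 6) +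
        4 * (Y₂ ^ 2 + Y₀ ^ 2 * (c ^ 2 * Y₀ + c ^ 3)) * (c ^ 2 * Y₁ ^ 6) ^ 2 + (c ^ 2 * Y₁ ^ 6) ^ 3)) +
      Y₂ ^ 5 * (Y₂ ^ 3 + 4 * Y₂ * Y₀ ^ 2 * (c ^ 2 * Y₀ + c ^ 3)) := by
  ring

/-! ## The plane `{X₂ = X₃ = 0}` -/

/-- **FEDDER CERTIFICATE ON THE PLANE (`p = 5`)**: at every maximal ideal `Q` of `k[X]/(h)` containing `x̄₂, x̄₃` but not all
`x̄ⱼ`, the local ring satisfies the Cohen–Macaulay + Frobenius-closed clause. [cite: Fedder1983, Thm. 1.12] -/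
theorem clause_plane_char5 (k : Type) [Field k] [CharP k 5] (h : MvPolynomial (Fin 4) k)
    (hh : h = X 2 ^ 2 + X 3 ^ 2 * (X 1 ^ 6 + X 0 ^ 3) + X 0 ^ 2 * X 3 ^ 3)
    (Q : Ideal (MvPolynomial (Fin 4) k ⧸ Ideal.span {h})) [Q.IsMaximal]
    (hQ2 : Ideal.Quotient.mk (Ideal.span {h}) (X 2) ∈ Q) (hQ3 : Ideal.Quotient.mk (Ideal.span {h}) (X 3) ∈ Q)
    (hj : ∃ j : Fin 4, Ideal.Quotient.mk (Ideal.span {h}) (X j) ∉ Q) :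
    ∀ d : ℕ, ringKrullDim (Localization.AtPrime Q) = d → ∀ s : Fin d → Localization.AtPrime Q,
      (Ideal.span (Set.range s)).radical.IsMaximal →
        RingTheory.Sequence.IsWeaklyRegular (Localization.AtPrime Q) (List.ofFn s) ∧
        ∀ y : Localization.AtPrime Q, (∃ e : ℕ, y ^ 5 ^ e ∈ Ideal.span
          ((fun z : Localization.AtPrime Q => z ^ 5 ^ e) ''
            (Ideal.span (Set.range s) : Set (Localization.AtPrime Q)))) → y ∈ Ideal.span (Set.range s) := by
  haveI : Fact (Nat.Prime 5) := ⟨Nat.prime_five⟩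
  -- the closed point `P = Q ∩ k[X]`
  haveI hPmax : (Q.comap (Ideal.Quotient.mk (Ideal.span {h}))).IsMaximal :=
    Ideal.comap_isMaximal_of_surjective _ Ideal.Quotient.mk_surjective
  -- the plane slicing
  obtain ⟨Ψ, hΨ0, hΨ1, hΨ2, hΨ3⟩ := exists_planeSlicing k
  have hy0 : Ψ.symm (X 0) = X 2 := Ψ.symm_apply_eq.mpr hΨ2.symm
  have hy1 : Ψ.symm (X 1) = X 3 := Ψ.symm_apply_eq.mpr hΨ3.symm
  have hb0 : Ψ.symm (C (X 0)) = X 0 := Ψ.symm_apply_eq.mpr hΨ0.symm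
  have hb1 : Ψ.symm (C (X 1)) = X 1 := Ψ.symm_apply_eq.mpr hΨ1.symm
  have hy : ∀ s : Fin 2, Ψ.symm (X s) ∈ Q.comap (Ideal.Quotient.mk (Ideal.span {h})) := by
    intro s
    fin_cases s
    · exact hy0 ▸ Ideal.mem_comap.mpr hQ2
    · exact hy1 ▸ Ideal.mem_comap.mpr hQ3
  -- the base point `𝔭 = P ∩ k[X₀,X₁]` and its generators
  haveI h𝔭 : ((Q.comap (Ideal.Quotient.mk (Ideal.span {h}))).comap (Ψ.symm.toRingHom.comp C)).IsMaximal :=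
    CoordinateSlicing.comap_slice_isMaximal Ψ _ hy
  obtain ⟨m, a, ha⟩ := Submodule.fg_iff_exists_fin_generating_family.mp
    (IsNoetherian.noetherian ((Q.comap (Ideal.Quotient.mk (Ideal.span {h}))).comap (Ψ.symm.toRingHom.comp C)))
  have hPA := CoordinateSlicing.eq_span_sliceFamily Ψ _ hy a ha
  have hh0 : h ≠ 0 := (HWeightedData.prime_h k h hh).1.ne_zero
  refine FedderAtMaximalIdeal.stub_fedderAtMaximalIdeal 5 k 4 (2 + m) _ h Q hPA hh0 ?_
  -- Fedder's test: `h⁴ ∉ (A_i⁵)`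
  intro hmem
  have hd : ∀ s : Fin 2, (Finsupp.single (0 : Fin 2) 4 + Finsupp.single 1 4 : Fin 2 →₀ ℕ) s < 5 := by
    intro s
    fin_cases s <;> simp
  have hext := CoordinateSlicing.coeff_mem_span_of_mem_span Ψ (Finsupp.single (0 : Fin 2) 4 + Finsupp.single 1 4)
    5 hd a hmem
  -- the extracted coefficient is `6 φ²`
  have hΨh : Ψ h = X 0 ^ 2 + X 1 ^ 2 * (C (X 1) ^ 6 + C (X 0) ^ 3) + C (X 0) ^ 2 * X 1 ^ 3 := by
    rw [hh]
    simp only [map_add, map_mul, map_pow, hΨ0, hΨ1, hΨ2, hΨ3]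
  have hval : coeff (Finsupp.single (0 : Fin 2) 4 + Finsupp.single 1 4) (Ψ (h ^ (5 - 1))) =
      6 * (X 1 ^ 6 + X 0 ^ 3) ^ 2 := by
    rw [map_pow, hΨh, show (5 - 1 : ℕ) = 4 from rfl, plane_quartic_identity]
    have e1 : (6 * (C (X 1) ^ 6 + C (X 0) ^ 3) ^ 2 : MvPolynomial (Fin 2) (MvPolynomial (Fin 2) k)) =
        C (6 * (X 1 ^ 6 + X 0 ^ 3) ^ 2) := by
      simp only [map_mul, map_pow, map_add, map_ofNat]
    have e2 : (X 0 ^ 4 * X 1 ^ 4 : MvPolynomial (Fin 2) (MvPolynomial (Fin 2) k)) =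
        monomial (Finsupp.single (0 : Fin 2) 4 + Finsupp.single 1 4) 1 := by
      rw [X_pow_eq_monomial, X_pow_eq_monomial, monomial_mul, one_mul]
    rw [e1, e2, coeff_add, coeff_add, coeff_C_mul, coeff_monomial, if_pos rfl, mul_one,
      coeff_X_pow_mul_eq_zero _ 0 5 (hd 0), coeff_X_pow_mul_eq_zero _ 1 5 (hd 1), add_zero, add_zero]
  rw [hval] at hext
  -- so `φ² ∈ 𝔞 = (a_j⁵) ⊆ 𝔭`
  have hφ2 : (X 1 ^ 6 + X 0 ^ 3 : MvPolynomial (Fin 2) k) ^ 2 ∈ Ideal.span (Set.range fun j => a j ^ 5) :=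
    (Ideal.unit_mul_mem_iff_mem _ (isUnit_six_char5 k)).mp hext
  have h𝔞 : Ideal.span (Set.range fun j => a j ^ 5) ≤
      (Q.comap (Ideal.Quotient.mk (Ideal.span {h}))).comap (Ψ.symm.toRingHom.comp C) := by
    rw [Ideal.span_le]
    rintro _ ⟨j, rfl⟩
    refine Ideal.pow_mem_of_mem _ ?_ 5 (by norm_num)
    rw [← ha]
    exact Ideal.subset_span (Set.mem_range_self j)
  by_cases hφ : (X 1 ^ 6 + X 0 ^ 3 : MvPolynomial (Fin 2) k) ∈
      (Q.comap (Ideal.Quotient.mk (Ideal.span {h}))).comap (Ψ.symm.toRingHom.comp C)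
  · -- `φ ∈ 𝔭`: then `X₀ ∉ 𝔭`, the curve `φ = 0` is regular at `𝔭`, and Fedder backwards gives `φ⁴ ∉ 𝔭^[5]`
    have hX0 : (X 0 : MvPolynomial (Fin 2) k) ∉
        (Q.comap (Ideal.Quotient.mk (Ideal.span {h}))).comap (Ψ.symm.toRingHom.comp C) := by
      intro hX0
      have hX1 : (X 1 : MvPolynomial (Fin 2) k) ∈
          (Q.comap (Ideal.Quotient.mk (Ideal.span {h}))).comap (Ψ.symm.toRingHom.comp C) := by
        refine h𝔭.isPrime.mem_of_pow_mem 6 ?_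
        have e : (X 1 ^ 6 : MvPolynomial (Fin 2) k) = (X 1 ^ 6 + X 0 ^ 3) - X 0 ^ 3 := by ring
        rw [e]
        exact Ideal.sub_mem _ hφ (Ideal.pow_mem_of_mem _ hX0 3 (by norm_num))
      have hX0' : (X 0 : MvPolynomial (Fin 4) k) ∈ Q.comap (Ideal.Quotient.mk (Ideal.span {h})) := by
        have := Ideal.mem_comap.mp hX0
        rwa [RingHom.comp_apply, RingEquiv.toRingHom_eq_coe, RingEquiv.coe_toRingHom, hb0] at this
      have hX1' : (X 1 : MvPolynomial (Fin 4) k) ∈ Q.comap (Ideal.Quotient.mk (Ideal.span {h})) := by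
        have := Ideal.mem_comap.mp hX1
        rwa [RingHom.comp_apply, RingEquiv.toRingHom_eq_coe, RingEquiv.coe_toRingHom, hb1] at this
      obtain ⟨j, hj⟩ := hj
      apply hj
      fin_cases j
      · exact Ideal.mem_comap.mp hX0'
      · exact Ideal.mem_comap.mp hX1'
      · exact hQ2
      · exact hQ3
    have hd0 : pderiv 0 (X 1 ^ 6 + X 0 ^ 3 : MvPolynomial (Fin 2) k) = 3 * X 0 ^ 2 := by
      simp only [map_add, pderiv_pow, pderiv_X_self, pderiv_X_of_ne (show (1 : Fin 2) ≠ 0 by decide)]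
      norm_num
    have hdn : pderiv 0 (X 1 ^ 6 + X 0 ^ 3 : MvPolynomial (Fin 2) k) ∉
        (Q.comap (Ideal.Quotient.mk (Ideal.span {h}))).comap (Ψ.symm.toRingHom.comp C) := by
      rw [hd0]
      intro h3
      exact hX0 (h𝔭.isPrime.mem_of_pow_mem 2 ((Ideal.unit_mul_mem_iff_mem _ (isUnit_three_char5 k)).mp h3))
    have hφ0 : (X 1 ^ 6 + X 0 ^ 3 : MvPolynomial (Fin 2) k) ≠ 0 := by
      intro h0
      have h1 := congrArg (MvPolynomial.eval ![(0 : k), 1]) h0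
      simp at h1
    -- the regular curve and its clause
    haveI hreg := HypersurfaceRegular.isRegularLocalRing_localization_quotient_of_pderiv_not_mem k 2
      (X 1 ^ 6 + X 0 ^ 3) 0 ((Q.comap (Ideal.Quotient.mk (Ideal.span {h}))).comap (Ψ.symm.toRingHom.comp C)) hφ hdn
    haveI : CharP (Localization.AtPrime ((Q.comap (Ideal.Quotient.mk (Ideal.span {h}))).comap
        (Ψ.symm.toRingHom.comp C)) ⧸ Ideal.span {algebraMap (MvPolynomial (Fin 2) k)
          (Localization.AtPrime ((Q.comap (Ideal.Quotient.mk (Ideal.span {h}))).comap (Ψ.symm.toRingHom.comp C)))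
            (X 1 ^ 6 + X 0 ^ 3)}) 5 :=
      charP_of_injective_ringHom (((Ideal.Quotient.mk _).comp ((algebraMap (MvPolynomial (Fin 2) k) _).comp
        (algebraMap k (MvPolynomial (Fin 2) k)))).injective) 5
    have hclause := (FiClauseOfRegular.stub_fiClauseOfRegular 5 (Localization.AtPrime ((Q.comap
      (Ideal.Quotient.mk (Ideal.span {h}))).comap (Ψ.symm.toRingHom.comp C)) ⧸ Ideal.span
        {algebraMap (MvPolynomial (Fin 2) k) (Localization.AtPrime ((Q.comap (Ideal.Quotient.mk
          (Ideal.span {h}))).comap (Ψ.symm.toRingHom.comp C))) (X 1 ^ 6 + X 0 ^ 3)})).2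
    have hnot := (FedderAtMaximalIdeal.fedder_criterion_maximalIdeal k 2 m 5
      ((Q.comap (Ideal.Quotient.mk (Ideal.span {h}))).comap (Ψ.symm.toRingHom.comp C)) a ha.symm
      (X 1 ^ 6 + X 0 ^ 3) hφ hφ0).mp hclause
    refine hnot ?_
    rw [show (5 - 1 : ℕ) = 2 + 2 from rfl, pow_add]
    exact Ideal.mul_mem_left _ _ hφ2
  · -- `φ ∉ 𝔭`: but `φ² ∈ 𝔭`
    exact hφ (h𝔭.isPrime.mem_of_pow_mem 2 (h𝔞 hφ2))

/-! ## The axis `{X₀ = X₁ = X₂ = 0}` -/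

/-- **FEDDER CERTIFICATE ON THE AXIS (`p = 5`)**: at every maximal ideal `Q` of `k[X]/(h)` containing `x̄₀, x̄₁, x̄₂` but
not `x̄₃`, the local ring satisfies the Cohen–Macaulay + Frobenius-closed clause. [cite: Fedder1983, Thm. 1.12] -/
theorem clause_axis_char5 (k : Type) [Field k] [CharP k 5] (h : MvPolynomial (Fin 4) k)
    (hh : h = X 2 ^ 2 + X 3 ^ 2 * (X 1 ^ 6 + X 0 ^ 3) + X 0 ^ 2 * X 3 ^ 3)
    (Q : Ideal (MvPolynomial (Fin 4) k ⧸ Ideal.span {h})) [Q.IsMaximal]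
    (hQ0 : Ideal.Quotient.mk (Ideal.span {h}) (X 0) ∈ Q) (hQ1 : Ideal.Quotient.mk (Ideal.span {h}) (X 1) ∈ Q)
    (hQ2 : Ideal.Quotient.mk (Ideal.span {h}) (X 2) ∈ Q) (hQ3 : Ideal.Quotient.mk (Ideal.span {h}) (X 3) ∉ Q) :
    ∀ d : ℕ, ringKrullDim (Localization.AtPrime Q) = d → ∀ s : Fin d → Localization.AtPrime Q,
      (Ideal.span (Set.range s)).radical.IsMaximal →
        RingTheory.Sequence.IsWeaklyRegular (Localization.AtPrime Q) (List.ofFn s) ∧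
        ∀ y : Localization.AtPrime Q, (∃ e : ℕ, y ^ 5 ^ e ∈ Ideal.span
          ((fun z : Localization.AtPrime Q => z ^ 5 ^ e) ''
            (Ideal.span (Set.range s) : Set (Localization.AtPrime Q)))) → y ∈ Ideal.span (Set.range s) := by
  haveI : Fact (Nat.Prime 5) := ⟨Nat.prime_five⟩
  haveI hPmax : (Q.comap (Ideal.Quotient.mk (Ideal.span {h}))).IsMaximal :=
    Ideal.comap_isMaximal_of_surjective _ Ideal.Quotient.mk_surjective
  obtain ⟨Ψ, hΨ0, hΨ1, hΨ2, hΨ3⟩ := exists_axisSlicing k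
  have hy0 : Ψ.symm (X 0) = X 0 := Ψ.symm_apply_eq.mpr hΨ0.symm
  have hy1 : Ψ.symm (X 1) = X 1 := Ψ.symm_apply_eq.mpr hΨ1.symm
  have hy2 : Ψ.symm (X 2) = X 2 := Ψ.symm_apply_eq.mpr hΨ2.symm
  have hb0 : Ψ.symm (C (X 0)) = X 3 := Ψ.symm_apply_eq.mpr hΨ3.symm
  have hy : ∀ s : Fin 3, Ψ.symm (X s) ∈ Q.comap (Ideal.Quotient.mk (Ideal.span {h})) := by
    intro s
    fin_cases s
    · exact hy0 ▸ Ideal.mem_comap.mpr hQ0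
    · exact hy1 ▸ Ideal.mem_comap.mpr hQ1
    · exact hy2 ▸ Ideal.mem_comap.mpr hQ2
  haveI h𝔭 : ((Q.comap (Ideal.Quotient.mk (Ideal.span {h}))).comap (Ψ.symm.toRingHom.comp C)).IsMaximal :=
    CoordinateSlicing.comap_slice_isMaximal Ψ _ hy
  obtain ⟨m, a, ha⟩ := Submodule.fg_iff_exists_fin_generating_family.mp
    (IsNoetherian.noetherian ((Q.comap (Ideal.Quotient.mk (Ideal.span {h}))).comap (Ψ.symm.toRingHom.comp C)))
  have hPA := CoordinateSlicing.eq_span_sliceFamily Ψ _ hy a ha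
  have hh0 : h ≠ 0 := (HWeightedData.prime_h k h hh).1.ne_zero
  refine FedderAtMaximalIdeal.stub_fedderAtMaximalIdeal 5 k 4 (3 + m) _ h Q hPA hh0 ?_
  intro hmem
  have hd : ∀ s : Fin 3, (Finsupp.single (0 : Fin 3) 4 + Finsupp.single 2 4 : Fin 3 →₀ ℕ) s < 5 := by
    intro s
    fin_cases s <;> simp
  have hext := CoordinateSlicing.coeff_mem_span_of_mem_span Ψ (Finsupp.single (0 : Fin 3) 4 + Finsupp.single 2 4)
    5 hd a hmem
  have hΨh : Ψ h = X 2 ^ 2 + C (X 0) ^ 2 * (X 1 ^ 6 + X 0 ^ 3) + X 0 ^ 2 * C (X 0) ^ 3 := by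
    rw [hh]
    simp only [map_add, map_mul, map_pow, hΨ0, hΨ1, hΨ2, hΨ3]
  have hval : coeff (Finsupp.single (0 : Fin 3) 4 + Finsupp.single 2 4) (Ψ (h ^ (5 - 1))) = 6 * X 0 ^ 6 := by
    rw [map_pow, hΨh, show (5 - 1 : ℕ) = 4 from rfl, axis_quartic_identity]
    have e1 : (6 * C (X 0) ^ 6 : MvPolynomial (Fin 3) (MvPolynomial (Fin 1) k)) = C (6 * X 0 ^ 6) := by
      simp only [map_mul, map_pow, map_ofNat]
    have e2 : (X 0 ^ 4 * X 2 ^ 4 : MvPolynomial (Fin 3) (MvPolynomial (Fin 1) k)) =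
        monomial (Finsupp.single (0 : Fin 3) 4 + Finsupp.single 2 4) 1 := by
      rw [X_pow_eq_monomial, X_pow_eq_monomial, monomial_mul, one_mul]
    rw [e1, e2, coeff_add, coeff_add, coeff_add, coeff_C_mul, coeff_monomial, if_pos rfl, mul_one,
      coeff_X_pow_mul_eq_zero _ 0 5 (hd 0), coeff_X_pow_mul_eq_zero _ 1 5 (hd 1),
      coeff_X_pow_mul_eq_zero _ 2 5 (hd 2), add_zero, add_zero, add_zero]
  rw [hval] at hext
  -- so `X₃⁶ ∈ 𝔭' ⊆ k[X₃]`, i.e. `X₃ ∈ P`: excluded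
  have h6 : (X 0 : MvPolynomial (Fin 1) k) ^ 6 ∈ Ideal.span (Set.range fun j => a j ^ 5) :=
    (Ideal.unit_mul_mem_iff_mem _ (isUnit_six_char5 k)).mp hext
  have h𝔞 : Ideal.span (Set.range fun j => a j ^ 5) ≤
      (Q.comap (Ideal.Quotient.mk (Ideal.span {h}))).comap (Ψ.symm.toRingHom.comp C) := by
    rw [Ideal.span_le]
    rintro _ ⟨j, rfl⟩
    refine Ideal.pow_mem_of_mem _ ?_ 5 (by norm_num)
    rw [← ha]
    exact Ideal.subset_span (Set.mem_range_self j)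
  have hX3 : (X 0 : MvPolynomial (Fin 1) k) ∈
      (Q.comap (Ideal.Quotient.mk (Ideal.span {h}))).comap (Ψ.symm.toRingHom.comp C) :=
    h𝔭.isPrime.mem_of_pow_mem 6 (h𝔞 h6)
  have hX3' : (X 3 : MvPolynomial (Fin 4) k) ∈ Q.comap (Ideal.Quotient.mk (Ideal.span {h})) := by
    have := Ideal.mem_comap.mp hX3
    rwa [RingHom.comp_apply, RingEquiv.toRingHom_eq_coe, RingEquiv.coe_toRingHom, hb0] at this
  exact hQ3 (Ideal.mem_comap.mp hX3')

end Summit.ResolutionOfSingularities.ResolutionOfSingularities.Theorems.FInjectiveMacaulayfication.HFedderCertificates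

end
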